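import Literature.NumberTheory.GaloisRepresentations.GaloisCohomologyKummerProofs
import Literature.NumberTheory.GaloisRepresentations.RestrictionCalculus
import HarnessLib

/-!
# The Kummer sequence `0 → μ_p → K̄ˣ → K̄ˣ → 0` of discrete `Γ_k`-modules (Serre II §1.2)

For a field `k` with absolute Galois group `Γ_k` and any `p ≥ 1`, the `p`-th power map on
`K̄ˣ` is onto (`K̄` algebraically closed) with kernel `μ_p(K̄)`: the short exact sequence
`0 → μ_p → K̄ˣ →(p) K̄ˣ → 0` of the tree's discrete Galois modules `DiscreteGaloisModule.mu k p`,
`DiscreteGaloisModule.units k` (`isSES_kummer`), and its restriction to every subgroup of `Γ_k`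
(`IsSES.res`).  (For `p = char k` one has `μ_p = 1` and the sequence degenerates, consistently.)

The file also provides the two homological consequences used in the proof of Serre II §3.1
Prop. 5 (`Literature.NumberTheory.GaloisRepresentations.tsen_fieldCdLE_one_of_trdeg_eq_one`):

* `IsSES.exists_d_eq_of_map_two` — for a short exact sequence `0 → A → B → C → 0` with
  `H¹(C) = 0`, a `2`-cocycle of `A` whose image in `B` is a coboundary is a coboundary (the
  segment `H¹(C) → H²(A) → H²(B)`, element form);
* `torsion_cochain` — cochains with values in a module killed by `n` are killed by `n`.

## References

* J.-P. Serre, *Cohomologie galoisienne* (1997), II §1.2 (suite de Kummer).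
  [SerreGaloisCohomology1997]
-/

noncomputable section

open CategoryTheory Topology Field

universe u

namespace Literature.NumberTheory.GaloisRepresentations

open _root_.TopRep _root_.ContRepresentation _root_.ContinuousCohomology DiscreteGaloisModule

/-! ### A homological lemma: `H¹(C) → H²(A) → H²(B)` in element form -/

section Chase

variable {k : Type*} [CommRing k] [TopologicalSpace k]
variable {G : Type u} [Group G] [TopologicalSpace G] [IsTopologicalGroup G]
variable {M₁ : Type u} [AddCommGroup M₁] [Module k M₁] [TopologicalSpace M₁] [DiscreteTopology M₁]
  [ContinuousSMul k M₁]
variable {M₂ : Type u} [AddCommGroup M₂] [Module k M₂] [TopologicalSpace M₂] [DiscreteTopology M₂]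
  [ContinuousSMul k M₂]
variable {M₃ : Type u} [AddCommGroup M₃] [Module k M₃] [TopologicalSpace M₃] [DiscreteTopology M₃]
  [ContinuousSMul k M₃]
variable {ρ₁ : ContinuousRep G k M₁} {ρ₂ : ContinuousRep G k M₂} {ρ₃ : ContinuousRep G k M₃}
variable {f : ρ₁.toTopRep ⟶ ρ₂.toTopRep} {g : ρ₂.toTopRep ⟶ ρ₃.toTopRep}

/-- **`H¹(C) = 0` makes `H²(A) → H²(B)` injective**, element form: for a short exact sequence
`0 → A → B → C → 0` of discrete modules with `H¹(G, C) = 0`, a `2`-cocycle `c` of `A` whose image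
`f c` is a coboundary is itself a coboundary. [folklore] -/
theorem IsSES.exists_d_eq_of_map_two [CompactSpace G] (h : IsSES f g)
    (h₃ : Subsingleton (continuousCohomology 1 ρ₃.toTopRep))
    (c : (homogeneousCochains ρ₁.toTopRep).X 2)
    (hc : ∃ b : (homogeneousCochains ρ₂.toTopRep).X 1,
      (homogeneousCochains ρ₂.toTopRep).d 1 2 b = (cochainsHom f).f 2 c) :
    ∃ e : (homogeneousCochains ρ₁.toTopRep).X 1, (homogeneousCochains ρ₁.toTopRep).d 1 2 e = c := by
  obtain ⟨b, hb⟩ := hc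
  -- `g b` is a `1`-cocycle of `C`, hence a coboundary `d e₃`
  have hgb : (homogeneousCochains ρ₃.toTopRep).d 1 2 ((cochainsHom g).f 1 b) = 0 := by
    rw [hom_f_d_apply (cochainsHom g) 1 2 b, hb]
    exact cochainsHom_comp_apply_eq_zero f g h.comp_eq_zero 2 c
  obtain ⟨e₃, he₃⟩ := (subsingleton_homology_succ_iff _ 0).1 h₃ _ hgb
  have he₃ : (homogeneousCochains ρ₃.toTopRep).d 0 1 e₃ = (cochainsHom g).f 1 b := he₃
  -- lift `e₃ = g e₂`; then `b - d e₂` dies under `g`, so it is `f b₁`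
  obtain ⟨e₂, rfl⟩ := cochainsHom_surjective g h.surjective 0 e₃
  have h0 : (cochainsHom g).f 1 (b - (homogeneousCochains ρ₂.toTopRep).d 0 1 e₂) = 0 := by
    rw [map_sub, ← hom_f_d_apply (cochainsHom g) 0 1 e₂, he₃, sub_self]
  obtain ⟨b₁, hb₁⟩ := cochainsHom_exact_mid f g h.injective h.exact_mid 1 _ h0
  refine ⟨b₁, cochainsHom_injective f h.injective 2 ?_⟩
  rw [← hom_f_d_apply (cochainsHom f) 1 2 b₁, hb₁, map_sub, d_d_apply _ 0 1 2 e₂, sub_zero, hb]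

/-- **Cochains with values in an `n`-torsion module are `n`-torsion** (the terms of the
standard resolution). [folklore] -/
theorem torsion_resolutionX (ρ : ContinuousRep G k M₁) (n : ℤ) (hn : ∀ m : M₁, n • m = 0) :
    ∀ (i : ℕ) (w : resolutionX ρ.toTopRep i), n • w = 0
  | 0, w => hn w
  | i + 1, F => by
    ext x : 1
    exact torsion_resolutionX ρ n hn i _

/-- **Cochains with values in an `n`-torsion module are `n`-torsion.** [folklore] -/
theorem torsion_cochain (ρ : ContinuousRep G k M₁) (n : ℤ) (hn : ∀ m : M₁, n • m = 0) (i : ℕ)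
    (c : (homogeneousCochains ρ.toTopRep).X i) : n • c = 0 :=
  Subtype.ext (torsion_resolutionX ρ n hn (i + 1) c.1)

end Chase

/-! ### The Kummer sequence -/

section Kummer

variable (k : Type u) [Field k] (p : ℕ)

/-- The underlying unit of an element of the carrier of `K̄ˣ`. [folklore] -/
def unitsVal (u : UnitsCarrier k) : (AlgebraicClosure k)ˣ := (UnitsCarrier.toAdditive u).toMul

/-- `unitsVal` is additive-to-multiplicative. [folklore] -/
@[simp] theorem unitsVal_add (u v : UnitsCarrier k) :
    unitsVal k (u + v) = unitsVal k u * unitsVal k v := rfl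

/-- `unitsVal (ofUnits x) = x`. [folklore] -/
@[simp] theorem unitsVal_ofUnits (x : (AlgebraicClosure k)ˣ) :
    unitsVal k (UnitsCarrier.ofUnits x) = x := rfl

/-- `unitsVal` is injective. [folklore] -/
theorem unitsVal_injective : Function.Injective (unitsVal k) := fun _ _ h =>
  UnitsCarrier.toAdditive.injective (Additive.toMul.injective h)

/-- The Galois action on `K̄ˣ` through `unitsVal`. [folklore] -/
@[simp] theorem unitsVal_apply (σ : absoluteGaloisGroup k) (u : UnitsCarrier k) :
    unitsVal k (units k σ u) = σ • unitsVal k u := rfl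

/-- `unitsVal (z • u) = (unitsVal u) ^ z`. [folklore] -/
@[simp] theorem unitsVal_zsmul (z : ℤ) (u : UnitsCarrier k) :
    unitsVal k (z • u) = unitsVal k u ^ z := rfl

/-- The inclusion `μ_p ↪ K̄ˣ` as an additive map of the carriers. [folklore] -/
def kummerInclAddHom : MuCarrier k p →+ UnitsCarrier k where
  toFun v := UnitsCarrier.ofUnits (muVal k p v)
  map_zero' := by rw [muVal_zero]; rfl
  map_add' v w := by rw [muVal_add]; rfl

/-- `unitsVal ∘ kummerIncl = muVal`. [folklore] -/
@[simp] theorem unitsVal_kummerInclAddHom (v : MuCarrier k p) :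
    unitsVal k (kummerInclAddHom k p v) = muVal k p v := rfl

/-- **The inclusion `μ_p → K̄ˣ`** as a morphism of discrete `Γ_k`-modules.
[cite: SerreGaloisCohomology1997, II §1.2] -/
def kummerι : (mu k p).toTopRep ⟶ (units k).toTopRep :=
  TopRep.ofHom ⟨⟨(kummerInclAddHom k p).toIntLinearMap, continuous_of_discreteTopology⟩,
    fun σ => by
      ext v
      apply unitsVal_injective
      change unitsVal k (kummerInclAddHom k p (mu k p σ v)) =
        unitsVal k (units k σ (kummerInclAddHom k p v))
      rw [unitsVal_kummerInclAddHom, muVal_apply, unitsVal_apply, unitsVal_kummerInclAddHom]⟩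

/-- `kummerι` on elements, through `unitsVal`. [folklore] -/
@[simp] theorem unitsVal_kummerι (v : MuCarrier k p) :
    unitsVal k ((kummerι k p).hom v) = muVal k p v := rfl

/-- **The `p`-th power map `K̄ˣ → K̄ˣ`** (`u ↦ p • u` additively) as a morphism of discrete
`Γ_k`-modules. [cite: SerreGaloisCohomology1997, II §1.2] -/
def kummerπ : (units k).toTopRep ⟶ (units k).toTopRep :=
  TopRep.ofHom ⟨⟨(p : ℤ) • LinearMap.id, continuous_of_discreteTopology⟩, fun σ => by
    ext u
    change (p : ℤ) • (units k σ u) = units k σ ((p : ℤ) • u)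
    rw [map_zsmul]⟩

/-- `kummerπ` on elements: `u ↦ p • u`. [folklore] -/
@[simp] theorem kummerπ_hom_apply (u : UnitsCarrier k) : (kummerπ k p).hom u = (p : ℤ) • u := rfl

/-- **The Kummer sequence `0 → μ_p → K̄ˣ →(p) K̄ˣ → 0` is short exact** for `p ≥ 1`: the `p`-th
power map is onto since `K̄` is algebraically closed (`IsAlgClosed.exists_pow_nat_eq`), and its
kernel is `μ_p` by definition. [cite: SerreGaloisCohomology1997, II §1.2] -/
theorem isSES_kummer (hp : 0 < p) : IsSES (kummerι k p) (kummerπ k p) where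
  comp_eq_zero := by
    ext v
    apply unitsVal_injective
    change unitsVal k ((p : ℤ) • (kummerι k p).hom v) = unitsVal k 0
    rw [unitsVal_zsmul, unitsVal_kummerι, zpow_natCast, muVal_pow_eq_one]
    rfl
  injective := fun v w h => muVal_injective k p (by
    have h' := congrArg (unitsVal k) h
    rwa [unitsVal_kummerι, unitsVal_kummerι] at h')
  exact_mid := fun u hu => by
    have hu' : unitsVal k u ^ p = 1 := by
      have h' := congrArg (unitsVal k) hu
      rwa [kummerπ_hom_apply, unitsVal_zsmul, zpow_natCast] at h'
    refine ⟨MuCarrier.ofRootsOfUnity ⟨unitsVal k u, (mem_rootsOfUnity _ _).2 hu'⟩,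
      unitsVal_injective k ?_⟩
    rfl
  surjective := fun u => by
    obtain ⟨z, hz⟩ := IsAlgClosed.exists_pow_nat_eq ((unitsVal k u : (AlgebraicClosure k)ˣ) :
      AlgebraicClosure k) hp
    have hz0 : z ≠ 0 := by
      rintro rfl
      rw [zero_pow hp.ne'] at hz
      exact (unitsVal k u).ne_zero hz.symm
    refine ⟨UnitsCarrier.ofUnits (Units.mk0 z hz0), unitsVal_injective k (Units.ext ?_)⟩
    rw [kummerπ_hom_apply, unitsVal_zsmul, zpow_natCast, unitsVal_ofUnits, Units.val_pow_eq_pow_val,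
      Units.val_mk0, hz]

/-- Elements of `μ_p` are killed by `p`, in the additive carrier. [folklore] -/
theorem zsmul_muCarrier_eq_zero (v : MuCarrier k p) : (p : ℤ) • v = 0 :=
  muVal_injective k p (by
    rw [muVal_zero]
    change muVal k p v ^ (p : ℤ) = 1
    rw [zpow_natCast, muVal_pow_eq_one])

/-- **`2`-cocycles of `μ_p` are killed by `p`** (over any subgroup `S ≤ Γ_k`), in the form
`((p : ℤ) ^ 1) • c = 0` consumed by `exists_d_eq_of_res_eq_d_of_psmul_eq_zero`. [folklore] -/
theorem psmul_cochain_mu_eq_zero {H : Type u} [Group H] [TopologicalSpace H] [IsTopologicalGroup H]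
    (φ : H →ₜ* absoluteGaloisGroup k) (i : ℕ)
    (c : (homogeneousCochains ((mu k p).restrict φ).toTopRep).X i) : ((p : ℤ) ^ 1) • c = 0 := by
  rw [pow_one]
  exact torsion_cochain ((mu k p).restrict φ) (p : ℤ) (zsmul_muCarrier_eq_zero k p) i c

end Kummer

end Literature.NumberTheory.GaloisRepresentations

end
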